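import Summits.AtomisticToContinuum.Crystallization.Theorems.ExcessDecayLiouvilleTelescopedEnvelope

/-!
# Route `ExcessDecayLiouville`: the cubic envelope from the per-scale data (nonlinear half, XXXIV)

Harmonic-replacement architecture for item `ExcessDecay` (stmt-AtomisticToContinuum-9334), nonlinear half.
At a fixed site at distance `d` from the centre, with the scales `ρ_m = ρ₀ ϑ^{2m}` and the heights
`H_m = √Γ · ρ₀ √ρ₀ · ϑ^{3m}` (`= √(Γ ρ_m³)`), the increments of the approximants between the scales `i ≤ m < j`
are `≤ K₁ H_m + K₂ (d + 11/10) H_m / ρ_m`; summing the two geometric series (`norm_sub_telescope`,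
`geom_sum_Ico_le`):
* `increments_sum_le` : `Σ_{i ≤ m < j} (K₁ H_m + K₂ (d + 11/10) H_m/ρ_m) ≤ K₁ H_i/(1 − ϑ³) + K₂ (d + 11/10) (H_i/ρ_i)/(1 − ϑ)`;
* `norm_sub_later_le` : `‖u − f j‖ ≤ ‖u − f i‖ + K₁ H_i/(1 − ϑ³) + K₂ (d + 11/10)(H_i/ρ_i)/(1 − ϑ)`.
The comparison of `H_i`, `H_i (d/ρ_i)` with the cubic profile `√(Γ d³)` on `d ≥ ρ_i` is `heights_le_profile`.
All `[folklore]`; helper lemmas, nothing here closes an item.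
-/

noncomputable section

namespace Summit.AtomisticToContinuum.Crystallization.Theorems.ExcessDecayLiouville

open scoped BigOperators

/-- **The two geometric sums of the increments.** [folklore] -/
theorem increments_sum_le {K₁ K₂ G ρ₀ ϑ d : ℝ} (hK₁ : 0 ≤ K₁) (hK₂ : 0 ≤ K₂) (hG : 0 ≤ G) (hρ₀ : 0 < ρ₀)
    (hϑ0 : 0 < ϑ) (hϑ1 : ϑ < 1) (hd : 0 ≤ d + 11 / 10) (i j : ℕ) :
    ∑ m ∈ Finset.Ico i j, (K₁ * (G * ρ₀ * ϑ ^ (3 * m)) + K₂ * (d + 11 / 10) * ((G * ρ₀ * ϑ ^ (3 * m)) / (ρ₀ * ϑ ^ (2 * m)))) ≤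
      K₁ * (G * ρ₀ * ϑ ^ (3 * i)) / (1 - ϑ ^ 3) + K₂ * (d + 11 / 10) * ((G * ρ₀ * ϑ ^ (3 * i)) / (ρ₀ * ϑ ^ (2 * i))) / (1 - ϑ) := by
  have hϑ3 : ϑ ^ 3 < 1 := pow_lt_one₀ hϑ0.le hϑ1 (by norm_num)
  -- rewrite the two families as c q^m
  have h1 : ∀ m : ℕ, K₁ * (G * ρ₀ * ϑ ^ (3 * m)) = (K₁ * G * ρ₀) * (ϑ ^ 3) ^ m := fun m => by rw [pow_mul]; ring
  have h2 : ∀ m : ℕ, K₂ * (d + 11 / 10) * ((G * ρ₀ * ϑ ^ (3 * m)) / (ρ₀ * ϑ ^ (2 * m))) = (K₂ * (d + 11 / 10) * G) * ϑ ^ m := by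
    intro m
    have hϑm : ϑ ^ (2 * m) ≠ 0 := pow_ne_zero _ hϑ0.ne'
    rw [show ϑ ^ (3 * m) = ϑ ^ (2 * m) * ϑ ^ m by rw [← pow_add]; ring_nf]
    field_simp
  rw [Finset.sum_add_distrib]
  have hs1 := geom_sum_Ico_le (c := K₁ * G * ρ₀) (q := ϑ ^ 3) (by positivity) (by positivity) hϑ3 i j
  have hs2 := geom_sum_Ico_le (c := K₂ * (d + 11 / 10) * G) (q := ϑ) (by positivity) hϑ0.le hϑ1 i j
  simp only [← h1] at hs1
  simp only [← h2] at hs2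
  exact add_le_add hs1 hs2

/-- **The approximant of a later scale against an earlier one** (see the module docstring). [folklore] -/
theorem norm_sub_later_le {E : Type*} [SeminormedAddCommGroup E] (u : E) (f : ℕ → E) {i j : ℕ} (hij : i ≤ j)
    {K₁ K₂ G ρ₀ ϑ d : ℝ} (hK₁ : 0 ≤ K₁) (hK₂ : 0 ≤ K₂) (hG : 0 ≤ G) (hρ₀ : 0 < ρ₀)
    (hϑ0 : 0 < ϑ) (hϑ1 : ϑ < 1) (hd : 0 ≤ d + 11 / 10)
    (hinc : ∀ m, i ≤ m → m < j →
      ‖f (m + 1) - f m‖ ≤ K₁ * (G * ρ₀ * ϑ ^ (3 * m)) + K₂ * (d + 11 / 10) * ((G * ρ₀ * ϑ ^ (3 * m)) / (ρ₀ * ϑ ^ (2 * m)))) :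
    ‖u - f j‖ ≤ ‖u - f i‖ + (K₁ * (G * ρ₀ * ϑ ^ (3 * i)) / (1 - ϑ ^ 3) +
      K₂ * (d + 11 / 10) * ((G * ρ₀ * ϑ ^ (3 * i)) / (ρ₀ * ϑ ^ (2 * i))) / (1 - ϑ)) := by
  refine (norm_sub_telescope u f hij).trans (add_le_add le_rfl ?_)
  refine le_trans (Finset.sum_le_sum fun m hm => ?_) (increments_sum_le hK₁ hK₂ hG hρ₀ hϑ0 hϑ1 hd i j)
  rw [Finset.mem_Ico] at hm
  exact hinc m hm.1 hm.2

/-- **Heights against the cubic profile**: on `ρ_i ≤ d` (`ρ_i = ρ₀ ϑ^{2i}`), the height `H_i = G ρ₀ ϑ^{3i}` with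
`G = √Γ √ρ₀` satisfies `H_i ≤ √(Γ d³)` and `d · H_i/ρ_i ≤ √(Γ d³)`. [folklore] -/
theorem heights_le_profile {Γ ρ₀ ϑ d : ℝ} (hΓ : 0 ≤ Γ) (hρ₀ : 0 < ρ₀) (hϑ0 : 0 < ϑ) (i : ℕ) (hd : ρ₀ * ϑ ^ (2 * i) ≤ d) :
    Real.sqrt Γ * Real.sqrt ρ₀ * ρ₀ * ϑ ^ (3 * i) ≤ Real.sqrt (Γ * d ^ 3) ∧
    d * ((Real.sqrt Γ * Real.sqrt ρ₀ * ρ₀ * ϑ ^ (3 * i)) / (ρ₀ * ϑ ^ (2 * i))) ≤ Real.sqrt (Γ * d ^ 3) := by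
  have hρi : 0 < ρ₀ * ϑ ^ (2 * i) := by positivity
  have hd0 : 0 < d := lt_of_lt_of_le hρi hd
  have hsq : (Real.sqrt Γ * Real.sqrt ρ₀ * ρ₀ * ϑ ^ (3 * i)) ^ 2 = Γ * (ρ₀ * ϑ ^ (2 * i)) ^ 3 := by
    rw [mul_pow, mul_pow, mul_pow, Real.sq_sqrt hΓ, Real.sq_sqrt hρ₀.le, ← pow_mul, show 3 * i * 2 = 2 * i * 3 by ring, pow_mul]
    ring
  have hH0 : 0 ≤ Real.sqrt Γ * Real.sqrt ρ₀ * ρ₀ * ϑ ^ (3 * i) := by positivity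
  constructor
  · refine Real.le_sqrt_of_sq_le ?_
    rw [hsq]
    gcongr
  · refine Real.le_sqrt_of_sq_le ?_
    -- (d H_i/ρ_i)² = Γ ρ_i d² ≤ Γ d³
    have e : (d * ((Real.sqrt Γ * Real.sqrt ρ₀ * ρ₀ * ϑ ^ (3 * i)) / (ρ₀ * ϑ ^ (2 * i)))) ^ 2 =
        Γ * (ρ₀ * ϑ ^ (2 * i)) * d ^ 2 := by
      rw [mul_pow, div_pow, hsq]
      field_simp
    rw [e]
    calc Γ * (ρ₀ * ϑ ^ (2 * i)) * d ^ 2 ≤ Γ * d * d ^ 2 := by gcongr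
      _ = Γ * d ^ 3 := by ring

end Summit.AtomisticToContinuum.Crystallization.Theorems.ExcessDecayLiouville

end
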